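import Summits.ResolutionOfSingularities.ResolutionOfSingularities.Theorems.PAlterationAssemblyLevels
import Summits.ResolutionOfSingularities.ResolutionOfSingularities.Theorems.PAlterationPicoverToRadicialBottomFrobenius
import HarnessLib

/-!
# `PAlteration.PicoverToRadicialBottom` (stmt-ResolutionOfSingularities-0556): the twisted relative Frobenius

Route `ResolutionOfSingularities/pAlteration`, crux `PicoverToRadicialBottom` (stmt-0556), line
`theta-finite-cofinite-roots`; helper file (`--supports`), stub `stub_relFrobeniusTwisted`.

Let `k` be a field of characteristic `p` and `k ⊆ L ⊆ k^{1/p^r}` an intermediate field, encoded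
by a ring homomorphism `ψ : L → k` ("`x ↦ x^{p^r}`") with `algebraMap k L (ψ x) = x^{p^r}`,
`ψ (algebraMap k L a) = a^{p^r}` and `ψ` FINITE (i.e. `k` finite over `L^{p^r}`). For a
`k`-scheme `X` locally of finite type with `p = 0` in `Γ(X, 𝒪_X)` and
`X_L := X ×_k Spec L = pullback f (Spec L → Spec k)`, the **twisted relative Frobenius**

  `Ψ := (F_X^r, f ≫ Spec ψ) : X → X_L`,  `F_X^r = powEndo X (p^r)`,

is well defined (`ψ ∘ algebraMap = Frob^r` on `k`, naturality `powEndo_comp` and `powEndo_Spec`),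
FINITE, universally injective and surjective: `Ψ ≫ pr₁ = F_X^r` is integral and radicial, so `Ψ`
is; `Ψ ≫ pr₂ = f ≫ Spec ψ` is locally of finite type because `Spec ψ` is finite, so `Ψ` is, and
finite = integral + locally of finite type; surjectivity holds because `pr₁` is injective on points
(base change of the radicial `Spec L → Spec k`) while `F_X^r` is the identity on points. This is
`exists_relFrobenius` (`PAlterationAssemblyLevels`) with the bijective level map `θ_m` replaced by
the finite `ψ`.
-/

-- single-problem summit: the doubled namespace component `ResolutionOfSingularities` is forced
set_option linter.dupNamespace false

noncomputable section

open CategoryTheory CategoryTheory.Limits AlgebraicGeometry TopologicalSpace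

open Literature.AlgebraicGeometry.Motives

namespace Summit.ResolutionOfSingularities.ResolutionOfSingularities.Theorems

/-- **The twisted relative Frobenius `Ψ : X → X ×_k Spec L`.** For a field `k` of characteristic
`p`, a field `L` with `k ⊆ L ⊆ k^{1/p^r}` given by `ψ : L → k`, `x ↦ x^{p^r}` (with
`ψ ∘ (k → L) = Frob^r` and `ψ` finite), and a `k`-scheme `X` locally of finite type of
characteristic `p`, the morphism `Ψ = (F_X^r, f ≫ Spec ψ) : X → pullback f (Spec L → Spec k)` is
finite, universally injective and surjective, with `Ψ ≫ pr₁ = F_X^r = powEndo X (p^r)` and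
`Ψ ≫ pr₂ = f ≫ Spec ψ`. [folklore] -/
theorem stub_relFrobeniusTwisted :
    ∀ (p : ℕ) [Fact p.Prime] (k : Type) [Field k] [CharP k p] (L : Type) [Field L] [Algebra k L]
      (r : ℕ) (ψ : L →+* k), (∀ x : L, algebraMap k L (ψ x) = x ^ p ^ r) →
      (∀ a : k, ψ (algebraMap k L a) = a ^ p ^ r) → ψ.Finite →
      ∀ (X : Scheme.{0}) (f : X ⟶ Spec (.of k)) [LocallyOfFiniteType f] (hX : (p : Γ(X, ⊤)) = 0),
      ∃ Ψ : X ⟶ pullback f (Spec.map (CommRingCat.ofHom (algebraMap k L))),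
        IsFinite Ψ ∧ UniversallyInjective Ψ ∧ Surjective Ψ ∧
        Ψ ≫ pullback.fst f (Spec.map (CommRingCat.ofHom (algebraMap k L))) =
          powEndo X (p ^ r) (pow_ne_zero r (Fact.out : p.Prime).ne_zero)
            (add_pow_prime_pow_sections X p hX r) ∧
        Ψ ≫ pullback.snd f (Spec.map (CommRingCat.ofHom (algebraMap k L))) =
          f ≫ Spec.map (CommRingCat.ofHom ψ) := by
  intro p _ k _ _ L _ _ r ψ hψL hψk hψfin X f _ hX
  set F := powEndo X (p ^ r) (pow_ne_zero r (Fact.out : p.Prime).ne_zero)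
    (add_pow_prime_pow_sections X p hX r) with hF
  -- `ψ ∘ algebraMap = Frob^r` on `k`
  have hψι : ψ.comp (algebraMap k L) = powRingHom k (p ^ r) (pow_ne_zero r (Fact.out : p.Prime).ne_zero)
      (fun a b => add_pow_char_pow a b p r) := by
    ext y
    simp only [RingHom.comp_apply, powRingHom_apply]
    exact hψk y
  -- the compatibility `F ≫ f = (f ≫ Spec ψ) ≫ Spec (algebraMap k L)`
  have hpk : (p : Γ(Spec (CommRingCat.of k), ⊤)) = 0 := natCast_appTop_eq_zero p (𝟙 _)
  have haddk := add_pow_sections p hpk r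
  have w : F ≫ f = (f ≫ Spec.map (CommRingCat.ofHom ψ)) ≫
      Spec.map (CommRingCat.ofHom (algebraMap k L)) := by
    rw [Category.assoc, ← Spec.map_comp]
    change F ≫ f = f ≫ Spec.map (CommRingCat.ofHom (ψ.comp (algebraMap k L)))
    rw [hψι, ← powEndo_Spec (p ^ r) _ k _ haddk, hF,
      powEndo_comp (p ^ r) (pow_ne_zero r (Fact.out : p.Prime).ne_zero) _ f haddk]
  let Ψ := pullback.lift F (f ≫ Spec.map (CommRingCat.ofHom ψ)) w
  have hΨF : Ψ ≫ pullback.fst _ _ = F := pullback.lift_fst _ _ _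
  have hΨs : Ψ ≫ pullback.snd _ _ = f ≫ Spec.map (CommRingCat.ofHom ψ) := pullback.lift_snd _ _ _
  -- radicial and surjective
  haveI : UniversallyInjective F := powEndo_universallyInjective' X p hX r
  haveI : UniversallyInjective (Ψ ≫ pullback.fst _ _) := by rw [hΨF]; infer_instance
  have hui : UniversallyInjective Ψ := universallyInjective_of_comp Ψ (pullback.fst _ _)
  haveI : CharP L p := charP_of_injective_algebraMap (algebraMap k L).injective p
  haveI : UniversallyInjective (Spec.map (CommRingCat.ofHom (algebraMap k L))) :=
    universallyInjective_specMap_field_of_pow_mem (algebraMap k L) p fun x => ⟨r, ψ x, hψL x⟩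
  haveI : UniversallyInjective
      (pullback.fst f (Spec.map (CommRingCat.ofHom (algebraMap k L)))) :=
    MorphismProperty.pullback_fst (P := @UniversallyInjective) _ _ ‹_›
  have hsurj : Surjective Ψ :=
    ⟨fun z => ⟨(pullback.fst f (Spec.map (CommRingCat.ofHom (algebraMap k L)))).base z,
      (pullback.fst f (Spec.map (CommRingCat.ofHom (algebraMap k L)))).injective (by
        rw [← Scheme.Hom.comp_apply, hΨF]; rfl)⟩⟩
  -- finite = integral + locally of finite type
  haveI : IsIntegralHom F := isIntegralHom_powEndo X (p ^ r) _ _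
  haveI : IsIntegralHom (Ψ ≫ pullback.fst _ _) := by rw [hΨF]; infer_instance
  have hint : IsIntegralHom Ψ := IsIntegralHom.of_comp Ψ (pullback.fst _ _)
  haveI : IsFinite (Spec.map (CommRingCat.ofHom ψ)) := (IsFinite.SpecMap_iff _).mpr hψfin
  haveI : LocallyOfFiniteType (Ψ ≫ pullback.snd _ _) := by rw [hΨs]; infer_instance
  have hlft : LocallyOfFiniteType Ψ := locallyOfFiniteType_of_comp Ψ (pullback.snd _ _)
  exact ⟨Ψ, (IsFinite.iff_isIntegralHom_and_locallyOfFiniteType Ψ).mpr ⟨hint, hlft⟩, hui, hsurj,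
    hΨF, hΨs⟩

end Summit.ResolutionOfSingularities.ResolutionOfSingularities.Theorems

end
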